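import Summits.MatrixMultiplication.MatrixMultiplication.Theorems.GradedDesignFamily.Negative.SubfieldCellNineLambda

/-!
# Subfield cell `GL₂(𝔽₉) ⊃ SL₂(𝔽₃)` at level one — II: the compression identity

**Honest framing.** VALUE = a kernel-checked finite certificate about ONE finite cell of
ONE skeleton line (`quadratic_extension_level_one_cell`, stub S3 `stub_subfieldCell`, crux
`GradedDesignFamily` of route `LevelGradedCohnUmans`), in the *standard model*
`(k, K, φ) = (𝔽₃, 𝔽₉, mapGL)`.  It is **not** progress on `Summit.MatrixMultiplication` (no bound on
`ω` is touched) and it does **not** refute `stub_subfieldCell`, whose quantifiers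
`∃ c > 0, ∀ N, ∃ (k, K, φ) …` are insensitive to any single cell.

## Content

* `σ : ℤ[√-3] →+* ℂ` (`√-3 ↦ i√3`, injective), `w r = σ ∘ vz r ∈ ℂ^20`.
* `Theta r cf = Σ_h σ(c h) · Σ_u cf u ((h·r) u)`: the `λ`-twisted `H`-average of the frame sums of a
  coefficient function `cf : 𝔽₉² → 𝔽₉² → ℂ` at `r`; `Edual cf ∈ ℂ^20` its twenty dual coordinates.
* **`two_Theta` (compression identity):** `2·Theta r cf = Σ_i w r i · Edual cf i`.  Hence every
  family of frame-sum conditions `Σ_u cf u ((h y y'⁻¹ z) u) = …` of a level-one separated design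
  becomes a family of *linear relations among the vectors `w_r ∈ ℂ^20`* (file III).
* `kprop p q` (`p` is a cyclic shift `q + j` of exponent codes, i.e. `v_p = ω^j v_q`), the 21
  candidate certificate functionals `cands` (20 coordinates + `specialPhi`), and
  `kprop_of_smul`: complex proportionality `w g₁ = c • w g₂` of λ-vectors of units forces `kprop`.

File IIb (`SubfieldCellNineLambdaCert`) computes the pool certificate; file III
(`SubfieldCellNineRowTwo`) proves `|Y| ≥ 2 ⇒ |Z| ≤ 17`.
-/

set_option linter.dupNamespace false

namespace Summit.MatrixMultiplication.MatrixMultiplication.Theorems.GradedDesignFamily.Negative.SubfieldNine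

open Matrix

/-! ### The embedding `σ : ℤ[√-3] → ℂ` and the compression identity -/

/-- `√-3 ↦ i√3`. -/
noncomputable def rt : {r : ℂ // r * r = ((-3 : ℤ) : ℂ)} :=
  ⟨(Real.sqrt 3 : ℂ) * Complex.I, by
    have h3 : ((Real.sqrt 3 : ℝ) : ℂ) * ((Real.sqrt 3 : ℝ) : ℂ) = (3 : ℂ) := by
      rw [← Complex.ofReal_mul, Real.mul_self_sqrt (by norm_num : (0:ℝ) ≤ 3)]; norm_num
    calc ((Real.sqrt 3 : ℂ) * Complex.I) * ((Real.sqrt 3 : ℂ) * Complex.I)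
        = (((Real.sqrt 3 : ℝ) : ℂ) * ((Real.sqrt 3 : ℝ) : ℂ)) * (Complex.I * Complex.I) := by ring
      _ = ((-3 : ℤ) : ℂ) := by rw [h3, Complex.I_mul_I]; norm_num⟩

/-- The ring embedding `ℤ[√-3] →+* ℂ`. -/
noncomputable def σ : ℤ√(-3) →+* ℂ := Zsqrtd.lift rt

/-- `σ` is injective (`-3` is not a square in `ℤ`). -/
theorem σ_injective : Function.Injective σ :=
  Zsqrtd.lift_injective rt (fun n h => by nlinarith [mul_self_nonneg n])

/-- `σ 2 = 2`. -/
theorem σ_two : σ 2 = 2 := map_ofNat σ 2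

/-- The complex λ-vector of a matrix. -/
noncomputable def w (r : Mat) (i : Idx) : ℂ := σ (vz r i)

/-- The twisted average `Θ_r(cf) = Σ_h σ(c(h)) · F_cf(h · r)` of the frame function of `cf`. -/
noncomputable def Theta (r : Mat) (cf : Vec → Vec → ℂ) : ℂ :=
  ∑ h : SL3, σ (cval (kexp h)) * ∑ u : Vec, cf u ((phiM h * r) *ᵥ u)

/-- The twenty "dual coordinates" of `cf`. -/
noncomputable def Edual (cf : Vec → Vec → ℂ) (i : Idx) : ℂ :=
  ∑ s : Kˣ, ∑ v : Vec, σ (Mfun (wrep i.2) (s⁻¹ • v)) * cf (s • uvec i.1) v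

/-- Re-summation `Σ_h σ(c h) g(h x) = Σ_v σ(M(x,v)) g v`. -/
theorem inner_sum (x : Vec) (g : Vec → ℂ) :
    ∑ h : SL3, σ (cval (kexp h)) * g (phiM h *ᵥ x) = ∑ v : Vec, σ (Mfun x v) * g v := by
  simp only [Mfun, map_sum, apply_ite σ, map_zero, Finset.sum_mul, ite_mul, zero_mul]
  rw [Finset.sum_comm]
  simp only [Finset.sum_ite_eq, Finset.mem_univ, if_true]

/-- `Θ_r(cf) = Σ_u Σ_v σ(M(r u, v)) cf u v`. -/
theorem Theta_eq (r : Mat) (cf : Vec → Vec → ℂ) :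
    Theta r cf = ∑ u : Vec, ∑ v : Vec, σ (Mfun (r *ᵥ u) v) * cf u v := by
  unfold Theta
  simp only [← Matrix.mulVec_mulVec, Finset.mul_sum]
  rw [Finset.sum_comm]
  refine Finset.sum_congr rfl fun u _ => ?_
  exact inner_sum (r *ᵥ u) (cf u)

/-- The line decomposition of `Σ_u`: `u = 0` or `u = s • u_t` uniquely. -/
theorem sum_lines (F : Vec → ℂ) :
    ∑ u : Vec, F u = F 0 + ∑ t : Fin 10, ∑ s : Kˣ, F (s • uvec t) := by
  rw [← (Equiv.ofBijective lineMap lineMap_bijective).sum_comp F, Fintype.sum_option,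
    Fintype.sum_prod_type, Finset.sum_comm]
  rfl

/-- `2 σ(m) = σ(2m)`. -/
theorem two_mul_σ (m : ℤ√(-3)) : 2 * σ m = σ (2 * m) := by
  rw [map_mul, σ_two]

/-- **Compression identity.** `2·Θ_r(cf) = Σ_i w_r(i) · E_i(cf)`. -/
theorem two_Theta (r : Mat) (cf : Vec → Vec → ℂ) :
    2 * Theta r cf = ∑ i : Idx, w r i * Edual cf i := by
  rw [Theta_eq, sum_lines, Matrix.mulVec_zero]
  simp only [fact_M0, map_zero, zero_mul, Finset.sum_const_zero, zero_add]
  rw [Fintype.sum_prod_type, Finset.mul_sum]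
  refine Finset.sum_congr rfl fun t _ => ?_
  -- left: 2 * Σ_s Σ_v σ(M(r (s•u_t)) v) cf (s•u_t) v ; right: Σ_O w r (t,O) * Edual cf (t,O)
  have key : ∀ s : Kˣ, ∀ v : Vec,
      2 * (σ (Mfun (r *ᵥ (s • uvec t)) v) * cf (s • uvec t) v) =
        σ (tabM (r *ᵥ uvec t) (s⁻¹ • v)) * cf (s • uvec t) v := by
    intro s v
    rw [← mul_assoc, two_mul_σ, Units.smul_def, Matrix.mulVec_smul, ← Units.smul_def, fact_D1]
  simp only [Finset.mul_sum, key]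
  simp only [w, vz, vc, mv2_eq, Edual]
  generalize r *ᵥ uvec t = x
  rcases htab : tab x with _ | ⟨O₀, e⟩
  · simp only [tabM, htab, map_zero, zero_mul, Finset.sum_const_zero, oval]
  · simp only [tabM, htab, map_mul, mul_assoc, ← Finset.mul_sum]
    have : ∀ O : Fin 2, σ (oval (if O₀ = O then some e else none)) =
        if O₀ = O then σ (cval e) else 0 := by
      intro O; split_ifs <;> simp [oval]
    simp only [this, ite_mul, zero_mul, Finset.sum_ite_eq, Finset.mem_univ, if_true]


/-! ### Exponent-code relations and the candidate functionals -/

/-- `p` is a cyclic shift of `q`: `p = ω^j · q` at the level of exponent codes. -/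
def kprop (p q : Idx → Option (ZMod 3)) : Prop := ∃ j : ZMod 3, ∀ i : Idx, p i = (q i).map (· + j)

/-- `kprop` is decidable. -/
instance instDecKprop (p q : Idx → Option (ZMod 3)) : Decidable (kprop p q) := by
  unfold kprop; infer_instance

/-- Integer functional applied to a `ℤ[√-3]`-vector. -/
def dotz (Φ : Idx → ℤ) (v : Idx → ℤ√(-3)) : ℤ√(-3) := ∑ i, v i * (Φ i : ℤ√(-3))

/-- Coordinate functional. -/
def coordPhi (i₀ : Idx) : Idx → ℤ := fun i => if i = i₀ then 1 else 0

/-- The one non-coordinate functional needed: `±1` on the slots of the lines `u_0,…,u_5`. -/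
def specialPhi : Idx → ℤ := fun i =>
  if i.1.val < 3 then (if i.2 = 0 then 1 else -1)
  else if i.1.val < 6 then (if i.2 = 0 then -1 else 1) else 0

/-- All twenty indices, as a list. -/
def allIdx : List Idx := (List.finRange 10).flatMap fun t => [(t, 0), (t, 1)]

/-- The 21 candidate functionals of the certificate search. -/
def cands : List (Idx → ℤ) := specialPhi :: allIdx.map coordPhi

/-! ### From complex proportionality to the code relation -/

/-- The λ-vector of a unit is non-zero. -/
theorem vz_ne_zero_of_unit (g : GL (Fin 2) K) : ∃ i : Idx, vz (g : Mat) i ≠ 0 :=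
  fact_nz _ (by rw [det2_eq]; exact Matrix.GeneralLinearGroup.det_ne_zero g)

/-- The complex λ-vector of a unit is non-zero. -/
theorem w_ne_zero (g : GL (Fin 2) K) : w (g : Mat) ≠ 0 := by
  obtain ⟨i, hi⟩ := vz_ne_zero_of_unit g
  intro h
  have := congrFun h i
  simp only [w, Pi.zero_apply] at this
  exact hi (σ_injective (by rw [this, map_zero]))

/-- Complex proportionality of λ-vectors of units forces a cyclic shift of exponent codes. -/
theorem kprop_of_smul {g₁ g₂ : GL (Fin 2) K} {c : ℂ} (hc : w (g₁ : Mat) = c • w (g₂ : Mat)) :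
    kprop (vc (g₁ : Mat)) (vc (g₂ : Mat)) := by
  obtain ⟨i₀, hi₀⟩ := vz_ne_zero_of_unit g₂
  have hw : ∀ i, w (g₁ : Mat) i = c * w (g₂ : Mat) i := fun i => by
    have := congrFun hc i; simpa using this
  -- the pivot entries
  rcases h₂ : vc (g₂ : Mat) i₀ with _ | e₀
  · exact absurd (by simp [vz, h₂, oval]) hi₀
  rcases h₁ : vc (g₁ : Mat) i₀ with _ | e₁
  · -- then c = 0 and w g₁ = 0
    exfalso
    have hc0 : c = 0 := by
      have := hw i₀
      simp only [w, vz, h₁, oval, map_zero] at this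
      have hne : σ (vz (g₂ : Mat) i₀) ≠ 0 := fun h => hi₀ (σ_injective (by rw [h, map_zero]))
      rw [vz] at hne
      exact (mul_eq_zero.mp this.symm).resolve_right hne
    apply w_ne_zero g₁
    funext i; rw [hw i, hc0, zero_mul]; rfl
  · refine ⟨e₁ - e₀, fun i => ?_⟩
    have key : w (g₁ : Mat) i * w (g₂ : Mat) i₀ = w (g₁ : Mat) i₀ * w (g₂ : Mat) i := by
      rw [hw i, hw i₀]; ring
    simp only [w] at key
    rw [← map_mul, ← map_mul] at key
    have key' := σ_injective key
    simp only [vz, h₁, h₂, oval] at key'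
    exact (cross_iff _ _ _ _).mp key'

end Summit.MatrixMultiplication.MatrixMultiplication.Theorems.GradedDesignFamily.Negative.SubfieldNine
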